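import Mathlib
import HarnessLib
import Summits.ResolutionOfSingularities.ResolutionOfSingularities.Theorems.HomologicalConductorSurfaceTerminationRationalDescent

/-!
# Kill test `SurfaceTermination` (stmt-ResolutionOfSingularities-16488): the E-descent is FACT-FREE —
# CAPTURE along the tower ⇒ TERMINATION, with no rationality hypothesis and no named fact

Route `ResolutionOfSingularities/HomologicalConductor`, support item `SurfaceTermination`
(stmt-ResolutionOfSingularities-16488), line `genus-descent` (registered skeleton c2da4ae6bde8d476).
OURS (hand leafhand-res-homologicalconduct-20, 2026-08-31); nothing here is a statement of the manuscript under
review (Hironaka 2017); AI-written, weaker than expert review.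

The landed theorem `SurfaceTermination.Descent.rationalStageTermination` (K44S-DESCENT (R2), res-L0-w44) proves
«a RATIONAL singular stage is followed by a regular stage» MODULO the six named facts of the line
(Cossart–Jannsen–Saito 2020, Lipman 1969 (1.2), (4.1), (12.1)(i)/(ii), Görtz–Wedhorn 24.44).  Reading its proof,
rationality and the facts enter at exactly two points: (a) the EXISTENCE of one resolution
`π : X ⟶ Spec T_(m₁+1)` of the singular stage (from Definition (1.1) of rationality), and (b) CAPTURE —
«`ca(T_i)·S` is principal for every regular local `k`-subalgebra `S ⊇ T_i` of `K`, essentially of finite type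
and dominating `T_i`» at every later singular stage `T_i` (res-L0-w44-stub-1's
`RationalDescent.isPrincipal_map_ca_of_isRegularLocalRing_dominating`, i.e. THEOREM A «`ca` is invertible on the
minimal resolution of a rational surface singularity» transported to `S`).  Everything else — the centre-ring
dictionary of `X` (`CentreRing.exists_centreRing_tower`), the exit divisor of a singular step
(`NoZeno.SandwichCluster.exists_exitDivisor`), the step lemma (`SurfaceTermination.tower_succ_le_of_isPrincipal`),
finiteness of the exceptional curve points — is unconditional tree mathematics.

This file records the abstraction:

* **`termination_of_capture`** (FACT-FREE, any valuation ring `O ∋ k`, any singular stage `T_(m₁+1)`): if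
  `T_(m₁+1)` admits a resolution and CAPTURE holds at every singular stage `T_i`, `i ≥ m₁ + 1`, then some stage
  of the canonical normalised `ca`-tower is a regular local ring.  Proof = the E-descent verbatim: the finite
  set `E j` of valuation rings that are centre rings of `X` and relatively dominate `T_j` is antitone in `j` and
  loses the exit divisor at every singular step.
* `rationalStageTermination_of_capture` — the landed (R2) theorem re-derived from it in its registered shape
  (resolution from Definition (1.1); capture from THEOREM A; rationality propagated along singular stages by
  Lipman (1.2)), showing the abstraction is faithful.
* **`surfaceTermination_of_resolution_of_capture`** — a DOOR to the item BY NAME: the route decl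
  `Theses.HomologicalConductor.SurfaceTermination` follows from two tower-wide hypotheses, (RES) «every singular
  stage `T_(m+1)` has a resolution» (for these excellent normal surface germs: Cossart–Jannsen–Saito / Lipman 1978,
  a named fact of the line) and (CAP) «CAPTURE at every singular stage `T_(m+1)`».  So a SUFFICIENT condition
  for the kill test beyond resolution of excellent surfaces is CAPTURE AT NON-RATIONAL STAGES: `ca(T)` generates
  an invertible ideal on every regular local ring dominating `T` — at rational stages this is THEOREM A (landed,
  modulo Lipman (1.2)/(4.1)/(12.1)).  HONEST CAVEAT: CAPTURE in this
  universal form asks that `ca(T)` have no base points on ANY regular model; at a non-rational stage whose `ca`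
  has base points on the minimal resolution it fails (at the local ring of a base point), although the tower may
  well go on to terminate (the normalised `ca`-blow-up first blows the base points up).  The descent itself only
  consumes principality at the centre rings of ONE resolution `X` of `T_(m₁+1)` for all later stages — a
  hypothesis EQUIVALENT to termination from `T_(m₁+1)` on (given resolutions), since a terminating tower has
  finitely many singular stages whose `ca`'s are principalised by a common resolution; typing that sharper door
  needs the centre-ring dictionary `CentreRing.exists_centreRing_tower` to expose the lifts `Spec 𝒪_{X,x} ⟶ X`,
  which is not done here.

No new definitions; no named-fact hypotheses except in the re-derivation of (R2).

References: J. Lipman, Publ. Math. IHÉS 36 (1969), (1.1), (1.2), (4.1) [`Lipman1969`]; O. Zariski, P. Samuel,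
*Commutative Algebra* II (1960), Ch. VI §17 (centres of valuations, domination) [`ZariskiSamuel1960`];
res-L0-w44 K44S-DESCENT (R2) (tree file `…SurfaceTerminationRationalDescent`).
-/

noncomputable section

-- single-problem summit: the doubled namespace component `ResolutionOfSingularities` is forced
set_option linter.dupNamespace false

namespace Summit.ResolutionOfSingularities.ResolutionOfSingularities.Theorems.SurfaceTermination.CaptureDescent

open CategoryTheory AlgebraicGeometry IsLocalRing
open Literature.AlgebraicGeometry.Resolution
open Literature.RingTheory.CohomologyAnnihilator (cohomologyAnnihilator)
open Summit.ResolutionOfSingularities.ResolutionOfSingularities.Theses.HomologicalConductor (SurfaceTermination)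
open Summit.ResolutionOfSingularities.ResolutionOfSingularities.Theorems.NoZeno.Birth
open Summit.ResolutionOfSingularities.ResolutionOfSingularities.Theorems.NoZeno.SandwichCluster
open Summit.ResolutionOfSingularities.ResolutionOfSingularities.Theorems.SurfaceTermination.Descent

variable {k K : Type} [Field k] [Field K] [Algebra k K]

/-! ## CAPTURE ⇒ TERMINATION (fact-free E-descent) -/

/-- **CAPTURE ⇒ TERMINATION (fact-free E-descent).**  For the route's datum (`k ⊆ O`, `A` finitely generated
with `Frac A = K`, `A ⊆ O`, `ringKrullDim A = 2`) and ANY valuation ring `O`: suppose the stage `T_(m₁+1)` of the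
canonical normalised `ca`-tower is singular and admits a resolution `π : X ⟶ Spec T_(m₁+1)`, and suppose
CAPTURE holds at every singular stage `T_i`, `i ≥ m₁ + 1`: for every regular local `k`-subalgebra `S` of `K`,
essentially of finite type over `k`, containing and dominating `T_i`, the extended ideal `ca(T_i)·S` is
principal (the exact shape of THEOREM A's tree form
`RationalDescent.isPrincipal_map_ca_of_isRegularLocalRing_dominating`, with rationality and the named facts
removed).  Then some stage is a regular local ring.  Proof: the E-descent of `Descent.rationalStageTermination`
verbatim with THEOREM A replaced by the hypothesis — the set `E j` of proper valuation rings of `K` that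
relatively dominate `T_j` and are centre rings of `X` is finite at `j = m₁ + 1` (integral exceptional curves),
antitone in `j`, and loses the exit divisor `W` of every singular step `T_j ↦ T_(j+1)` (capture + the step
lemma put every stage up to `T_(j+1)` inside the centre ring of `W` on `X`, which is then `W` itself by essential
generation); so at most `#E (m₁+1) + 1` further stages are singular. [cite: ZariskiSamuel1960, Ch. VI §17] -/
theorem termination_of_capture
    (O : ValuationSubring K) (A : Subalgebra k K) (hk : ∀ c : k, algebraMap k K c ∈ O) (hA : A.FG)
    (hfr : IsFractionRing ↥A K) (hAO : A.toSubring ≤ O.toSubring) (hdimA : ringKrullDim ↥A = 2)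
    (m₁ : ℕ) (hsing₁ : ¬ IsRegularLocalRing ↥(tower O A (m₁ + 1)))
    (hres : ∃ (X : Scheme.{0}) (π : X ⟶ Spec (.of ↥(tower O A (m₁ + 1)))), IsResolution π)
    (hcap : ∀ i : ℕ, m₁ + 1 ≤ i → ¬ IsRegularLocalRing ↥(tower O A i) →
      ∀ (S : Subalgebra k K) (hTS : tower O A i ≤ S),
        (∀ t ∈ tower O A i, t⁻¹ ∈ S → t⁻¹ ∈ tower O A i) →
        IsRegularLocalRing ↥S → Algebra.EssFiniteType k ↥S →
        (Ideal.map (Subalgebra.inclusion hTS).toRingHom (cohomologyAnnihilator ↥(tower O A i))).IsPrincipal) :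
    ∃ m : ℕ, IsRegularLocalRing ↥(tower O A m) := by
  classical
  haveI := hfr
  have htr : Algebra.trdeg k K = 2 := trdeg_eq_two_of_ringKrullDim A hA hfr hdimA
  -- abbreviations and the stage package at `m₁ + 1`
  have hmono : ∀ {i j : ℕ}, i ≤ j → tower O A i ≤ tower O A j :=
    fun hij _ hx => d2rc_mem_tower_of_le O A hij hx
  have hTO : ∀ (j : ℕ) (t : K), t ∈ tower O A j → t ∈ O :=
    fun j t ht => mem_valuationSubring_of_mem_tower O hk hAO j t ht
  -- stages are dominated by `O`: an element of `T_j` inverted in `O` is inverted in `T_j` (`T_j = loc O B`)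
  have inv_mem_tower_of_inv_mem : ∀ (j : ℕ) {t : K}, t ∈ tower O A j → t⁻¹ ∈ O → t⁻¹ ∈ tower O A j := by
    intro j t ht hti
    by_cases ht0 : t = 0
    · subst ht0; rw [inv_zero]; exact (tower O A j).zero_mem
    obtain ⟨B, hBO, hTB⟩ := exists_tower_eq_loc O A hk hAO j
    have htO : t ∈ O := hTO j t ht
    rw [hTB, loc_eq_locAt] at ht ⊢
    exact SyzygyFlattening.inv_mem_locAt O B hBO ht
      (SyzygyFlattening.valuation_eq_one_of_inv_mem O htO hti ht0)
  haveI : IsNoetherianRing ↥(tower O A (m₁ + 1)) := stub_towerNoetherian k K O A hk hA hfr hAO _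
  haveI : IsLocalRing ↥(tower O A (m₁ + 1)) := by
    obtain ⟨B, hBO, hTB⟩ := exists_tower_eq_loc O A hk hAO (m₁ + 1)
    rw [hTB, loc_eq_locAt]; exact SyzygyFlattening.isLocalRing_locAt O B hBO
  have hdimT : ringKrullDim ↥(tower O A (m₁ + 1)) = 2 :=
    ringKrullDim_tower_eq_two_of_not_isRegularLocalRing O A hk hA hfr hAO htr m₁ hsing₁
  haveI : IsIntegrallyClosed ↥(tower O A (m₁ + 1)) := d2rc_isIntegrallyClosed_tower_succ O A hk hA hfr hAO m₁
  -- ONE resolution of the singular stage, fixed for the whole descent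
  obtain ⟨X, π, hπ⟩ := hres
  haveI : IsProper π := hπ.isProper
  have hexcfin : (excCurvePoints π).Finite :=
    (excPoints_finite π).subset (hπ.excCurvePoints_subset_excPoints hdimT)
  -- the centre-ring dictionary
  obtain ⟨ctr, hctrT, hctrReg, hctrInt, hctrEft, hcentre, hcurve⟩ :=
    CentreRing.exists_centreRing_tower O A hk hA hfr hAO htr m₁ hsing₁ X π hπ
  -- the measure
  let E : ℕ → Set (ValuationSubring K) := fun j =>
    {V | V ≠ ⊤ ∧ (tower O A j).toSubring ≤ V.toSubring ∧
      (∀ t ∈ tower O A j, t⁻¹ ∈ V → t⁻¹ ∈ tower O A j) ∧ ∃ x, ((ctr x : Set K) = (V : Set K))}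
  have hE : ∀ j V, V ∈ E j ↔ (V ≠ ⊤ ∧ (tower O A j).toSubring ≤ V.toSubring ∧
      (∀ t ∈ tower O A j, t⁻¹ ∈ V → t⁻¹ ∈ tower O A j) ∧ ∃ x, ((ctr x : Set K) = (V : Set K))) :=
    fun j V => Iff.rfl
  -- (F1) finiteness at `m₁ + 1`
  have hfin : (E (m₁ + 1)).Finite := by
    have himg : ((fun x => ((ctr x : Subalgebra k K) : Set K)) '' excCurvePoints π).Finite :=
      hexcfin.image _
    refine (himg.preimage (Set.injOn_of_injective SetLike.coe_injective)).subset ?_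
    intro V hV
    obtain ⟨hVtop, -, hVdom, x, hx⟩ := (hE _ V).mp hV
    exact ⟨x, hcurve x V hVtop hVdom hx, hx⟩
  -- (F2) antitone
  have hanti : ∀ j, E (j + 1) ⊆ E j := by
    intro j V hV
    obtain ⟨hVtop, hTV, hVdom, hx⟩ := (hE _ V).mp hV
    refine (hE _ V).mpr ⟨hVtop, fun t ht => hTV (Subalgebra.mem_toSubring.mpr (hmono (Nat.le_succ j) ht)),
      fun t ht hti => ?_, hx⟩
    have h1 : t⁻¹ ∈ tower O A (j + 1) := hVdom t (hmono (Nat.le_succ j) ht) hti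
    exact inv_mem_tower_of_inv_mem j ht (hTO _ _ h1)
  -- singular stages below a singular stage
  have hsing_of_le : ∀ {i j : ℕ}, i ≤ j → ¬ IsRegularLocalRing ↥(tower O A j) →
      ¬ IsRegularLocalRing ↥(tower O A i) :=
    fun hij hj hi => hj (isRegularLocalRing_tower_of_le O A hk hfr hAO hij hi)
  -- (F3) strictness at a singular step: the exit divisor is lost
  have hstrict : ∀ j, m₁ + 1 ≤ j → ¬ IsRegularLocalRing ↥(tower O A (j + 1)) →
      ∃ W ∈ E j, W ∉ E (j + 1) := by
    intro j hj hsingj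
    obtain ⟨n, rfl⟩ : ∃ n, j = n + 1 := ⟨j - 1, by omega⟩
    obtain ⟨W, hWtop, -, hTW, hgen, hdomW, ⟨t₀, ht₀, ht₀i, ht₀n⟩, -⟩ :=
      exists_exitDivisor O A hk hA hfr hAO htr n hsingj
    have hTW' : ∀ {i : ℕ}, i ≤ n + 1 + 1 → (tower O A i).toSubring ≤ W.toSubring :=
      fun hi t ht => hTW (Subalgebra.mem_toSubring.mpr (hmono hi ht))
    refine ⟨W, (hE _ W).mpr ⟨hWtop, hTW' (Nat.le_succ _), hdomW, ?_⟩,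
      fun hW => ?_⟩
    swap
    · -- `W` does not dominate `T_(j+1)`
      obtain ⟨-, -, hdom', -⟩ := (hE _ W).mp hW
      exact ht₀n (hdom' t₀ ht₀ ht₀i)
    -- the centre ring `S` of `W` on `X`
    have hdom₁ : ∀ t ∈ tower O A (m₁ + 1), t⁻¹ ∈ W → t⁻¹ ∈ tower O A (m₁ + 1) := by
      intro t ht hti
      have h1 : t⁻¹ ∈ tower O A (n + 1) := hdomW t (hmono hj ht) hti
      exact inv_mem_tower_of_inv_mem _ ht (hTO _ _ h1)
    obtain ⟨x, hxW, hxdom⟩ := hcentre W (hTW' (by omega)) hdom₁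
    refine ⟨x, ?_⟩
    -- every stage up to `T_(j+1)` lies in `S := ctr x` (capture + step lemma, induction on the stage)
    have hstages : ∀ i, m₁ + 1 ≤ i → i ≤ n + 1 + 1 → tower O A i ≤ ctr x := by
      intro i hi
      induction i, hi using Nat.le_induction with
      | base => exact fun _ => hctrT x
      | succ i hi ih =>
        intro hi'
        have hTS : tower O A i ≤ ctr x := ih (by omega)
        obtain ⟨d, rfl⟩ : ∃ d, i = d + 1 := ⟨i - 1, by omega⟩
        have hsingi : ¬ IsRegularLocalRing ↥(tower O A (d + 1)) := hsing_of_le (by omega) hsingj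
        -- `S` dominates `T_i`
        have hdomS : ∀ t ∈ tower O A (d + 1), t⁻¹ ∈ ctr x → t⁻¹ ∈ tower O A (d + 1) := by
          intro t ht hti
          have h1 : t⁻¹ ∈ tower O A (n + 1) :=
            hdomW t (hmono (by omega) ht) (hxW (Subalgebra.mem_toSubring.mpr hti))
          exact inv_mem_tower_of_inv_mem _ ht (hTO _ _ h1)
        -- capture: `ca(T_i)·S` is principal
        have hprinc := hcap (d + 1) hi hsingi (ctr x) hTS hdomS (hctrReg x) (hctrEft x)
        -- the step lemma with `V := W`
        exact SurfaceTermination.tower_succ_le_of_isPrincipal O A (d + 1) W.toSubring (hTW' hi') (ctr x) hTS hxW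
          hxdom (hctrInt x) hprinc
    have hTjS : tower O A (n + 1 + 1) ≤ ctr x := hstages (n + 1 + 1) (by omega) le_rfl
    -- `W ≤ S` (essential generation) and `S ≤ W`
    refine Set.Subset.antisymm (fun s hs => hxW (Subalgebra.mem_toSubring.mpr hs)) ?_
    intro w hw
    obtain ⟨a, ha, s, hs, hsi, rfl⟩ := hgen w hw
    exact (ctr x).mul_mem (hTjS ha) (hxdom s (hTjS hs) hsi)
  -- (F4) the descent
  have key : ∀ (c j : ℕ), m₁ + 1 ≤ j → (E j).Finite → (E j).ncard ≤ c →
      ∃ m : ℕ, IsRegularLocalRing ↥(tower O A m) := by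
    intro c
    induction c with
    | zero =>
      intro j hj hfinj hcard
      by_cases hreg : IsRegularLocalRing ↥(tower O A (j + 1))
      · exact ⟨_, hreg⟩
      obtain ⟨W, hW, -⟩ := hstrict j hj hreg
      have h0 : E j = ∅ := (Set.ncard_eq_zero hfinj).mp (Nat.le_zero.mp hcard)
      rw [h0] at hW
      exact absurd hW (Set.notMem_empty W)
    | succ c ih =>
      intro j hj hfinj hcard
      by_cases hreg : IsRegularLocalRing ↥(tower O A (j + 1))
      · exact ⟨_, hreg⟩
      obtain ⟨W, hWj, hWj1⟩ := hstrict j hj hreg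
      have hsub : E (j + 1) ⊆ E j := hanti j
      have hlt : (E (j + 1)).ncard < (E j).ncard :=
        Set.ncard_lt_ncard (Set.ssubset_iff_subset_ne.mpr ⟨hsub, fun h => hWj1 (h ▸ hWj)⟩) hfinj
      exact ih (j + 1) (by omega) (hfinj.subset hsub) (by omega)
  exact key _ (m₁ + 1) le_rfl hfin le_rfl

/-! ## Faithfulness: (R2) re-derived -/

/-- **(R2) re-derived from `termination_of_capture` (the abstraction is faithful).**  Modulo the six named facts:
a RATIONAL stage `T_(m₁+1)` is followed by a regular stage — resolution from Definition (1.1) of rationality;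
rationality propagates along singular stages (`RationalDescent.hasRationalSingularity_tower_succ`, Lipman (1.2));
CAPTURE from THEOREM A (`RationalDescent.isPrincipal_map_ca_of_isRegularLocalRing_dominating`).  Same statement as
the landed `Descent.rationalStageTermination`. [cite: Lipman1969, Proposition (1.2) and Theorem (4.1) (pp. 199, 204)] -/
theorem rationalStageTermination_of_capture
    (hF : (CossartJannsenSaito2020General.{0} ∧ Lipman1969_1_2.{0} ∧ Lipman1969_4_1.{0} ∧
      Lipman1969_12_1_i.{0} ∧ Lipman1969_12_1_ii.{0} ∧
      Literature.AlgebraicGeometry.Morphisms.GortzWedhorn2023_24_44_H2.{0}))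
    (O : ValuationSubring K) (A : Subalgebra k K) (hk : ∀ c : k, algebraMap k K c ∈ O) (hA : A.FG)
    (hfr : IsFractionRing ↥A K) (hAO : A.toSubring ≤ O.toSubring) (hdimA : ringKrullDim ↥A = 2)
    (m₁ : ℕ) (hrat₁ : HasRationalSingularity ↥(tower O A (m₁ + 1))) :
    ∃ m : ℕ, IsRegularLocalRing ↥(tower O A m) := by
  by_cases hreg₁ : IsRegularLocalRing ↥(tower O A (m₁ + 1))
  · exact ⟨_, hreg₁⟩
  have h12 : Lipman1969_1_2.{0} := hF.2.1
  have htr : Algebra.trdeg k K = 2 := trdeg_eq_two_of_ringKrullDim A hA hfr hdimA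
  have hsing_of_le : ∀ {i j : ℕ}, i ≤ j → ¬ IsRegularLocalRing ↥(tower O A j) →
      ¬ IsRegularLocalRing ↥(tower O A i) :=
    fun hij hj hi => hj (isRegularLocalRing_tower_of_le O A hk hfr hAO hij hi)
  -- rationality along singular stages (Lipman (1.2))
  have hrat_of : ∀ i, m₁ + 1 ≤ i → ¬ IsRegularLocalRing ↥(tower O A i) →
      HasRationalSingularity ↥(tower O A i) := by
    intro i hi
    induction i, hi using Nat.le_induction with
    | base => exact fun _ => hrat₁
    | succ i hi ih =>
      intro hsing'
      obtain ⟨n, rfl⟩ : ∃ n, i = n + 1 := ⟨i - 1, by omega⟩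
      have hsing : ¬ IsRegularLocalRing ↥(tower O A (n + 1)) := hsing_of_le (Nat.le_succ _) hsing'
      exact RationalDescent.hasRationalSingularity_tower_succ h12 O A hk hA hfr hAO htr n hsing (ih hsing)
  obtain ⟨X, π, hπ, -⟩ := id hrat₁
  refine termination_of_capture O A hk hA hfr hAO hdimA m₁ hreg₁ ⟨X, π, hπ⟩ ?_
  intro i hi hsingi S hTS hdomS hSreg hSeft
  obtain ⟨d, rfl⟩ : ∃ d, i = d + 1 := ⟨i - 1, by omega⟩
  exact RationalDescent.isPrincipal_map_ca_of_isRegularLocalRing_dominating hF O A hk hA hfr hAO htr d hsingi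
    (hrat_of (d + 1) hi hsingi) S hTS hdomS hSreg hSeft

/-! ## A door to the item: resolution of singular stages + CAPTURE ⇒ `SurfaceTermination` BY NAME -/

/-- **DOOR: (RES) + (CAP) ⇒ `SurfaceTermination` (stmt-ResolutionOfSingularities-16488) BY NAME, fact-free.**
(RES): along every tower of the route's datum, a SINGULAR stage `T_(m+1)` admits a resolution
`X ⟶ Spec T_(m+1)` (for these excellent normal two-dimensional local rings: resolution of excellent surfaces,
Lipman 1978 / Cossart–Jannsen–Saito 2020 — a named fact of the line, not assumed here in any particular typed
form).  (CAP): at every singular stage `T_(m+1)`, `ca(T_(m+1))·S` is principal for every regular local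
`k`-subalgebra `S ⊇ T_(m+1)` of `K` essentially of finite type and dominating `T_(m+1)` (THEOREM A at rational
stages; OPEN at non-rational stages — the kernel of the kill test in this form).  Then the route decl holds: stage
`T_1` is regular, or singular and `termination_of_capture` applies from `m₁ = 0`.
[cite: Lipman1969, Definition (1.1) and Theorem (4.1) (pp. 199, 204)] -/
theorem surfaceTermination_of_resolution_of_capture
    (hRES : ∀ (k K : Type) [Field k] [Field K] [Algebra k K] (O : ValuationSubring K) (A : Subalgebra k K),
      (∀ c : k, algebraMap k K c ∈ O) → A.FG → IsFractionRing ↥A K → A.toSubring ≤ O.toSubring →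
      ringKrullDim ↥A = 2 → ∀ m : ℕ, ¬ IsRegularLocalRing ↥(tower O A (m + 1)) →
      ∃ (X : Scheme.{0}) (π : X ⟶ Spec (.of ↥(tower O A (m + 1)))), IsResolution π)
    (hCAP : ∀ (k K : Type) [Field k] [Field K] [Algebra k K] (O : ValuationSubring K) (A : Subalgebra k K),
      (∀ c : k, algebraMap k K c ∈ O) → A.FG → IsFractionRing ↥A K → A.toSubring ≤ O.toSubring →
      ringKrullDim ↥A = 2 → ∀ m : ℕ, ¬ IsRegularLocalRing ↥(tower O A (m + 1)) →
      ∀ (S : Subalgebra k K) (hTS : tower O A (m + 1) ≤ S),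
        (∀ t ∈ tower O A (m + 1), t⁻¹ ∈ S → t⁻¹ ∈ tower O A (m + 1)) →
        IsRegularLocalRing ↥S → Algebra.EssFiniteType k ↥S →
        (Ideal.map (Subalgebra.inclusion hTS).toRingHom
          (cohomologyAnnihilator ↥(tower O A (m + 1)))).IsPrincipal) :
    SurfaceTermination := by
  intro p _hp k K _ _ _ _ O A hk hA hfr hAO hdimA ca loc chart nrm tower'
  show ∃ m : ℕ, IsRegularLocalRing ↥(NoZeno.Birth.tower O A m)
  by_cases hreg₁ : IsRegularLocalRing ↥(NoZeno.Birth.tower O A (0 + 1))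
  · exact ⟨_, hreg₁⟩
  refine termination_of_capture O A hk hA hfr hAO hdimA 0 hreg₁ (hRES k K O A hk hA hfr hAO hdimA 0 hreg₁) ?_
  intro i hi hsingi S hTS hdomS hSreg hSeft
  obtain ⟨d, rfl⟩ : ∃ d, i = d + 1 := ⟨i - 1, by omega⟩
  exact hCAP k K O A hk hA hfr hAO hdimA d hsingi S hTS hdomS hSreg hSeft

end Summit.ResolutionOfSingularities.ResolutionOfSingularities.Theorems.SurfaceTermination.CaptureDescent

end
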